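import Summits.SmoothPoincare4.SmoothPoincare4.Theorems.DottedCircleRasmussenDcrGapHelperHandlebodyChartModelHandlesCollarAux

/-!
# Helper `helper_handlebodyChart_modelHandles` (M3: handle structure of the model dotted handlebody `D_k`)
# of line `mk_friends` for crux `DcrGap` — squeezes compose (swept angles add)
(item stmt-SmoothPoincare4-16128, route route-SmoothPoincare4-DottedCircleRasmussen)

**Registered piece `helper_handlebodyChart_modelHandles_squeezeComp` of the model lemma M3.**  The squeeze
clause of the data stub `helper_handlebodyChart_modelHandles_data` (part 2 of its split) asks for a
diffeomorphism `κ` of `ℝ⁴`, the identity off a compact subset of a given open `U`, commuting with the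
rotations `(z, w) ↦ (z, u w)` of the `w`-plane, together with smooth rotation-invariant lifts `SW_l` near
`D_k` of the angles its planar shadow sweeps about the hole centres `c_l`:
`u(z(κ x) - c_l) = e^{i SW_l(x)} u(z(x) - c_l)` on `D_k` (`u(v) = v/|v|`).  The squeeze is built in stages
(collar push `…ModelHandlesCollarPhase`, radial squeeze of the `w`-fibres, inflation of the holes, cut-off
radial flow towards the base centre); this file proves that such packages **compose**: if `κ₁` carries a
set `S` into a set `S₂` on which the package of `κ₂` holds, then `κ₂ ∘ κ₁` is again such a package on
`S`, supported in `K₁ ∪ K₂`, with lifts `SW_l = SW¹_l + SW²_l ∘ κ₁` on `N₁ ∩ κ₁⁻¹(N₂)`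
(`ModelHandles.squeeze_comp`: the swept angles of composed moves add).

No definitions, no named facts, no `sorry`.  References: M. W. Hirsch, *Differential Topology* (1976),
Ch. 8 §1 [HirschDT1976].
-/

-- the prescribed namespace `Summit.<P>.<Sub>.…` duplicates `SmoothPoincare4` (P = Sub)
set_option linter.dupNamespace false
set_option linter.style.longLine false
noncomputable section

open scoped Manifold ContDiff Topology
open Function Set Metric Filter
open Literature.Topology.FourManifolds Literature.Topology.FourManifolds.MMSW
open Literature.AlgebraicTopology.Homotopy.HopfFibration

namespace Summit.SmoothPoincare4.SmoothPoincare4.Theorems.DcrGap.MkFriends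

namespace ModelHandles

/-- **Equivariant compactly supported squeezes with swept-angle lifts compose** (see the module
docstring): supports unite, the composite commutes with the rotations of the `w`-plane, and the swept
angles add, `SW_l = SW¹_l + SW²_l ∘ κ₁`, smooth on `N₁ ∩ κ₁⁻¹(N₂)`. [folklore] -/
theorem squeeze_comp {k : ℕ} {U S S₂ : Set (EuclideanSpace ℝ (Fin 4))}
    (κ₁ κ₂ : EuclideanSpace ℝ (Fin 4) ≃ₘ⟮𝓡 4, 𝓡 4⟯ EuclideanSpace ℝ (Fin 4))
    {K₁ K₂ N₁ N₂ : Set (EuclideanSpace ℝ (Fin 4))} {SW₁ SW₂ : Fin k → EuclideanSpace ℝ (Fin 4) → ℝ}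
    (h1c : IsCompact K₁) (h1U : K₁ ⊆ U) (h1id : ∀ x, x ∉ K₁ → κ₁ x = x)
    (h1rot : ∀ v : ℂ, ‖v‖ = 1 → ∀ x, κ₁ (fibreRot (fun _ => v) x) = fibreRot (fun _ => v) (κ₁ x))
    (h1o : IsOpen N₁) (h1S : S ⊆ N₁) (h1s : ∀ l, ContDiffOn ℝ ∞ (SW₁ l) N₁)
    (h1inv : ∀ l (v : ℂ), ‖v‖ = 1 → ∀ x, SW₁ l (fibreRot (fun _ => v) x) = SW₁ l x)
    (h1sw : ∀ l, ∀ x ∈ S, (zC (κ₁ x) - holeCentre k l) / ((‖zC (κ₁ x) - holeCentre k l‖ : ℝ) : ℂ) =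
      Complex.exp ((SW₁ l x : ℂ) * Complex.I) * ((zC x - holeCentre k l) / ((‖zC x - holeCentre k l‖ : ℝ) : ℂ)))
    (h2c : IsCompact K₂) (h2U : K₂ ⊆ U) (h2id : ∀ x, x ∉ K₂ → κ₂ x = x)
    (h2rot : ∀ v : ℂ, ‖v‖ = 1 → ∀ x, κ₂ (fibreRot (fun _ => v) x) = fibreRot (fun _ => v) (κ₂ x))
    (h2o : IsOpen N₂) (h2S : S₂ ⊆ N₂) (h2s : ∀ l, ContDiffOn ℝ ∞ (SW₂ l) N₂)
    (h2inv : ∀ l (v : ℂ), ‖v‖ = 1 → ∀ x, SW₂ l (fibreRot (fun _ => v) x) = SW₂ l x)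
    (h2sw : ∀ l, ∀ x ∈ S₂, (zC (κ₂ x) - holeCentre k l) / ((‖zC (κ₂ x) - holeCentre k l‖ : ℝ) : ℂ) =
      Complex.exp ((SW₂ l x : ℂ) * Complex.I) * ((zC x - holeCentre k l) / ((‖zC x - holeCentre k l‖ : ℝ) : ℂ)))
    (hmap : MapsTo κ₁ S S₂) :
    ∃ (κ : EuclideanSpace ℝ (Fin 4) ≃ₘ⟮𝓡 4, 𝓡 4⟯ EuclideanSpace ℝ (Fin 4)) (K N₀ : Set (EuclideanSpace ℝ (Fin 4)))
      (SW : Fin k → EuclideanSpace ℝ (Fin 4) → ℝ), IsCompact K ∧ K ⊆ U ∧ (∀ x, x ∉ K → κ x = x) ∧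
      (∀ v : ℂ, ‖v‖ = 1 → ∀ x, κ (fibreRot (fun _ => v) x) = fibreRot (fun _ => v) (κ x)) ∧
      (∀ x, κ x = κ₂ (κ₁ x)) ∧ IsOpen N₀ ∧ S ⊆ N₀ ∧ (∀ l, ContDiffOn ℝ ∞ (SW l) N₀) ∧
      (∀ l (v : ℂ), ‖v‖ = 1 → ∀ x, SW l (fibreRot (fun _ => v) x) = SW l x) ∧
      ∀ l, ∀ x ∈ S, (zC (κ x) - holeCentre k l) / ((‖zC (κ x) - holeCentre k l‖ : ℝ) : ℂ) =
        Complex.exp ((SW l x : ℂ) * Complex.I) * ((zC x - holeCentre k l) / ((‖zC x - holeCentre k l‖ : ℝ) : ℂ)) := by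
  have hκ₁s : ContDiff ℝ ∞ (κ₁ : EuclideanSpace ℝ (Fin 4) → EuclideanSpace ℝ (Fin 4)) :=
    contMDiff_iff_contDiff.1 κ₁.contMDiff
  refine ⟨κ₁.trans κ₂, K₁ ∪ K₂, N₁ ∩ κ₁ ⁻¹' N₂, fun l x => SW₁ l x + SW₂ l (κ₁ x), h1c.union h2c,
    union_subset h1U h2U, fun x hx => ?_, fun v hv x => ?_, fun x => rfl, h1o.inter (h2o.preimage κ₁.continuous),
    fun x hx => ⟨h1S hx, h2S (hmap hx)⟩, fun l => ?_, fun l v hv x => ?_, fun l x hx => ?_⟩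
  · rw [mem_union, not_or] at hx
    show κ₂ (κ₁ x) = x
    rw [h1id x hx.1, h2id x hx.2]
  · show κ₂ (κ₁ (fibreRot (fun _ => v) x)) = fibreRot (fun _ => v) (κ₂ (κ₁ x))
    rw [h1rot v hv, h2rot v hv]
  · refine ContDiffOn.add ((h1s l).mono inter_subset_left) ?_
    exact (h2s l).comp (hκ₁s.contDiffOn) (fun x hx => hx.2)
  · show SW₁ l (fibreRot (fun _ => v) x) + SW₂ l (κ₁ (fibreRot (fun _ => v) x)) = SW₁ l x + SW₂ l (κ₁ x)
    rw [h1inv l v hv, h1rot v hv, h2inv l v hv]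
  · show (zC (κ₂ (κ₁ x)) - holeCentre k l) / ((‖zC (κ₂ (κ₁ x)) - holeCentre k l‖ : ℝ) : ℂ) = _
    rw [h2sw l (κ₁ x) (hmap hx), h1sw l x hx]
    push_cast
    rw [add_mul, Complex.exp_add]
    ring

end ModelHandles

/-- **Registered piece `helper_handlebodyChart_modelHandles_squeezeComp` of the model lemma M3 (equivariant
compactly supported squeezes of `ℝ⁴` with swept-angle lifts compose)**: the composite `κ₂ ∘ κ₁` is supported in
`K₁ ∪ K₂`, commutes with the rotations of the `w`-plane, and sweeps the angle `SW¹_l + SW²_l ∘ κ₁` about each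
hole centre, smoothly on `N₁ ∩ κ₁⁻¹(N₂)` (`ModelHandles.squeeze_comp`). [folklore] -/
theorem helper_handlebodyChart_modelHandles_squeezeComp : ∀ (k : ℕ) (U S S₂ : Set (EuclideanSpace ℝ (Fin 4))) (κ₁ κ₂ : EuclideanSpace ℝ (Fin 4) ≃ₘ⟮𝓡 4, 𝓡 4⟯ EuclideanSpace ℝ (Fin 4)) (K₁ K₂ N₁ N₂ : Set (EuclideanSpace ℝ (Fin 4))) (SW₁ SW₂ : Fin k → EuclideanSpace ℝ (Fin 4) → ℝ), IsCompact K₁ → K₁ ⊆ U → (∀ x, x ∉ K₁ → κ₁ x = x) → (∀ v : ℂ, ‖v‖ = 1 → ∀ x, κ₁ (Literature.Topology.FourManifolds.MMSW.fibreRot (fun _ => v) x) = Literature.Topology.FourManifolds.MMSW.fibreRot (fun _ => v) (κ₁ x)) → IsOpen N₁ → S ⊆ N₁ → (∀ l, ContDiffOn ℝ ((⊤ : ℕ∞) : WithTop ℕ∞) (SW₁ l) N₁) → (∀ l (v : ℂ), ‖v‖ = 1 → ∀ x, SW₁ l (Literature.Topology.FourManifolds.MMSW.fibreRot (fun _ =>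 v) x) = SW₁ l x) → (∀ l, ∀ x ∈ S, (Literature.AlgebraicTopology.Homotopy.HopfFibration.zC (κ₁ x) - Literature.Topology.FourManifolds.MMSW.holeCentre k l) / ((‖Literature.AlgebraicTopology.Homotopy.HopfFibration.zC (κ₁ x) - Literature.Topology.FourManifolds.MMSW.holeCentre k l‖ : ℝ) : ℂ) = Complex.exp ((SW₁ l x : ℂ) * Complex.I) * ((Literature.AlgebraicTopology.Homotopy.HopfFibration.zC x - Literature.Topology.FourManifolds.MMSW.holeCentre k l) / ((‖Literature.AlgebraicTopology.Homotopy.HopfFibration.zC x - Literature.Topology.FourManifolds.MMSW.holeCentre k l‖ : ℝ) : ℂ))) → IsCompact K₂ → K₂ ⊆ U → (∀ x, x ∉ K₂ → κ₂ x = x) → (∀ v : ℂ, ‖v‖ = 1 → ∀ x, κ₂ (Literature.Topology.FourManifolds.MMSW.fibreRot (fun _ => v) x) = Literature.Topology.FourManifolds.MMSW.fibreRot (fun _ => v) (κ₂ x)) → IsOpen N₂ → S₂ ⊆ N₂ → (∀ l, ContDiffOn ℝ ((⊤ : ℕ∞) : WithTop ℕ∞) (SW₂ l) N₂) → (∀ l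 (v : ℂ), ‖v‖ = 1 → ∀ x, SW₂ l (Literature.Topology.FourManifolds.MMSW.fibreRot (fun _ => v) x) = SW₂ l x) → (∀ l, ∀ x ∈ S₂, (Literature.AlgebraicTopology.Homotopy.HopfFibration.zC (κ₂ x) - Literature.Topology.FourManifolds.MMSW.holeCentre k l) / ((‖Literature.AlgebraicTopology.Homotopy.HopfFibration.zC (κ₂ x) - Literature.Topology.FourManifolds.MMSW.holeCentre k l‖ : ℝ) : ℂ) = Complex.exp ((SW₂ l x : ℂ) * Complex.I) * ((Literature.AlgebraicTopology.Homotopy.HopfFibration.zC x - Literature.Topology.FourManifolds.MMSW.holeCentre k l) / ((‖Literature.AlgebraicTopology.Homotopy.HopfFibration.zC x - Literature.Topology.FourManifolds.MMSW.holeCentre k l‖ : ℝ) : ℂ))) → Set.MapsTo κ₁ S S₂ → ∃ (κ : EuclideanSpace ℝ (Fin 4) ≃ₘ⟮𝓡 4, 𝓡 4⟯ EuclideanSpace ℝ (Fin 4)) (K N₀ : Set (EuclideanSpace ℝ (Fin 4))) (SW : Fin k → EuclideanSpace ℝ (Fin 4) → ℝ), IsCompact K ∧ K ⊆ U ∧ (∀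 x, x ∉ K → κ x = x) ∧ (∀ v : ℂ, ‖v‖ = 1 → ∀ x, κ (Literature.Topology.FourManifolds.MMSW.fibreRot (fun _ => v) x) = Literature.Topology.FourManifolds.MMSW.fibreRot (fun _ => v) (κ x)) ∧ (∀ x, κ x = κ₂ (κ₁ x)) ∧ IsOpen N₀ ∧ S ⊆ N₀ ∧ (∀ l, ContDiffOn ℝ ((⊤ : ℕ∞) : WithTop ℕ∞) (SW l) N₀) ∧ (∀ l (v : ℂ), ‖v‖ = 1 → ∀ x, SW l (Literature.Topology.FourManifolds.MMSW.fibreRot (fun _ => v) x) = SW l x) ∧ ∀ l, ∀ x ∈ S, (Literature.AlgebraicTopology.Homotopy.HopfFibration.zC (κ x) - Literature.Topology.FourManifolds.MMSW.holeCentre k l) / ((‖Literature.AlgebraicTopology.Homotopy.HopfFibration.zC (κ x) - Literature.Topology.FourManifolds.MMSW.holeCentre k l‖ : ℝ) : ℂ) = Complex.exp ((SW l x : ℂ) * Complex.I) * ((Literature.AlgebraicTopology.Homotopy.HopfFibration.zC x - Literature.Topology.FourManifolds.MMSW.holeCentre k l) / ((‖Literature.AlgebraicTopology.Homotopy.HopfFibration.zC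 x - Literature.Topology.FourManifolds.MMSW.holeCentre k l‖ : ℝ) : ℂ)) :=
  fun _ _ _ _ κ₁ κ₂ _ _ _ _ _ _ h1c h1U h1id h1rot h1o h1S h1s h1inv h1sw h2c h2U h2id h2rot h2o h2S h2s h2inv h2sw hmap =>
    ModelHandles.squeeze_comp κ₁ κ₂ h1c h1U h1id h1rot h1o h1S h1s h1inv h1sw h2c h2U h2id h2rot h2o h2S h2s
      h2inv h2sw hmap

end Summit.SmoothPoincare4.SmoothPoincare4.Theorems.DcrGap.MkFriends

end
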